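import Summits.PneNP.PneNP.Cruxes.FoolingMeasure.NormalCycleSystems

/-!
# Grading lemma for normal cycle systems (crux-ideate round 2, seat 2, g14) — `stmt-PneNP-19727`

Restricted-model rung; nothing here bears on P vs NP.

In a NORMAL cycle system (`CycleSystem.Normal`: along every ruler, every edge of every other cycle spans a forward
distance `≡ 2 (mod 3)`), fix a ruler `k` and a base vertex `v` (the seam of frame `k` is the edge `{v, succ_k v}`), and
measure heights above the seam, `ht w = (pos_k w − pos_k v − 1) mod n ∈ [0, n)`.  The frame colouring is
`seamColour S k v w = ht w mod 3`; orient every properly coloured edge `x → y` iff `colour y ≡ colour x + 1 (mod 3)`.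

`foreign_step_graded` : for every FOREIGN edge `{u, succ_i u}` (`i ≠ k`) the two heights differ, and
  * if `ht u < ht (succ_i u)` then `colour (succ_i u) ≡ colour u + 2`, i.e. the arc points from `succ_i u` DOWN to `u`;
  * if `ht (succ_i u) < ht u` then `colour (succ_i u) ≡ colour u + 1`, i.e. the arc points from `u` DOWN to `succ_i u`.

So in frame `k` EVERY foreign arc points to the endpoint of smaller height, while the ruler-`k` arcs climb by one
(`pos_succ`).  Consequences used in `IDEATION-CENSUS-r2s2g14.md` §7 (Table C8): a vertex of height `h` has foreign
out-degree `#{foreign neighbours of height < h}` — vertices low on ruler `k` are sinks-but-for-the-ruler ("bottom zone"),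
vertices high on it are sources-but-for-the-ruler ("top zone") in EVERY normal system, not only in circulants; this is the
structural reason the shallow Type-U/D seam repairs and the pattern junta of §7 transfer from circulant to random normal systems.
-/

namespace Summit.PneNP.PneNP.Cruxes.FoolingMeasure.GradingR2s2g14

open Summit.PneNP.PneNP.Cruxes.FoolingMeasure.IdeasR2g3
open Fin.CommRing

variable {q t : ℕ}

/-- GRADING: along a foreign edge `{u, succ_i u}` of a normal system the frame-`k` height changes, and the frame colour
changes by `+2 (mod 3)` when the height goes up and by `+1 (mod 3)` when it goes down — equivalently, the induced arc
always points to the endpoint of smaller height. -/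
theorem foreign_step_graded (S : CycleSystem q t) (hN : S.Normal) {i k : Fin t} (hik : i ≠ k)
    (v u : Fin (3 * q + 1)) :
    ((S.pos k u - S.pos k v - 1).val < (S.pos k (S.succ i u) - S.pos k v - 1).val ∧
        (S.pos k (S.succ i u) - S.pos k v - 1).val % 3 = ((S.pos k u - S.pos k v - 1).val + 2) % 3) ∨
      ((S.pos k (S.succ i u) - S.pos k v - 1).val < (S.pos k u - S.pos k v - 1).val ∧
        (S.pos k (S.succ i u) - S.pos k v - 1).val % 3 = ((S.pos k u - S.pos k v - 1).val + 1) % 3) := by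
  have hD : (S.pos k (S.succ i u) - S.pos k u).val % 3 = 2 := hN k i (Ne.symm hik) u
  have hB : S.pos k (S.succ i u) - S.pos k v - 1 =
      (S.pos k u - S.pos k v - 1) + (S.pos k (S.succ i u) - S.pos k u) := by ring
  rw [hB, Fin.val_add]
  set A := S.pos k u - S.pos k v - 1 with hA
  set D := S.pos k (S.succ i u) - S.pos k u with hD'
  have hAlt := A.isLt
  have hDlt := D.isLt
  by_cases h : A.val + D.val < 3 * q + 1
  · rw [Nat.mod_eq_of_lt h]
    left
    constructor <;> omega
  · rw [Nat.mod_eq_sub_mod (by omega), Nat.mod_eq_of_lt (by omega)]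
    right
    constructor <;> omega

/-- The colour form of the grading: the frame colour of `succ_i u` is never equal to that of `u` (cf. `seam_proper`)
and is `colour u + 2` exactly when the step goes up in height. -/
theorem seamColour_foreign_step (S : CycleSystem q t) (hN : S.Normal) {i k : Fin t} (hik : i ≠ k)
    (v u : Fin (3 * q + 1)) :
    ((S.pos k u - S.pos k v - 1).val < (S.pos k (S.succ i u) - S.pos k v - 1).val ∧
        (seamColour S k v (S.succ i u)).val = ((seamColour S k v u).val + 2) % 3) ∨
      ((S.pos k (S.succ i u) - S.pos k v - 1).val < (S.pos k u - S.pos k v - 1).val ∧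
        (seamColour S k v (S.succ i u)).val = ((seamColour S k v u).val + 1) % 3) := by
  rcases foreign_step_graded S hN hik v u with ⟨h1, h2⟩ | ⟨h1, h2⟩
  · left; refine ⟨h1, ?_⟩; simp only [seamColour]; omega
  · right; refine ⟨h1, ?_⟩; simp only [seamColour]; omega

end Summit.PneNP.PneNP.Cruxes.FoolingMeasure.GradingR2s2g14
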